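import Summits.QuantumFields.YangMills.Theorems.BalabanUVNodesN15KingModelFullPropagatorOperatorPrinted

/-!
# BalabanUVNodes ∕ N15 — THE KING-MODEL RUNG, CURVED EDITION (PART Q4b): THE (3.42) ENTRY `|Δ_U Gλ|` OF THE TWO-SPACING PAIR OF KING'S FULL
# `A = 0` PROPAGATOR, PRINTED SHAPE, THROUGH THE EQUATION — `Δ^ηA₀⁻¹λ = m²·A₀⁻¹λ + a_K·Q*QA₀⁻¹λ − λ`:
# `|Δ^{η′}(A₀′⁻¹(λ∘π))(x′) − (Δ^ηA₀⁻¹λ)(x)| ≤ C·(L^{−γ∕2})^K·e^{−δ·dist(B(x), supp λ)}·‖λ‖_∞` for EVERY η-lattice source `λ`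
# (Track A, DAG node N15 = NE2; FAN-OUT v1.1 §N15 s3 «KING-MODEL RUNG …»; PART Q = NE2⁰'s OPERATOR LAYER ((3.42) sup entries) for King's full
# propagator with genuine η-lattice test functions)

HONEST FRAMING.  Count-neutral kernel bookkeeping (cell `pub-ymgap`, seat `pub-ymgap-dag-n15-e` g7; `--supports stmt-QuantumFields-20292 --as helper`
= K3⁗ `SpineGivenEndpointR13Sep`).  TEMPLATE LITERATURE, `A = 0`: C. King's scalar U(1)-Higgs MODEL on finite tori ([King1986] (2.13)–(2.17) p. 653,
(4.1)–(4.5) p. 670 (`A₀ = η^d(−Δ^η + m²) + aQᵀQ` up to normalisation), Theorem 3.3 (3.7) p. 658, Prop. 3.8 (3.71) p. 664, p. 664 «x′ ∈ B^n(x)»; [Ba 4]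
(1.6) `G_k(Ω, A) = (−Δ_A + m² + a_kP_k(A))⁻¹`, (1.10)), NOT Bałaban's covariant objects; the statement is the (2.17)-summed SHAPE of (3.7) + (3.71)
in [B9]'s fourth-(3.42)-entry currency at `U ≡ 1`, not a printed proposition; NE2⁺ NOT PRINTED ∕ not proved; NOT a node discharge; nothing continuum ∕
ℝ⁴ ∕ OS ∕ mass-gap ∕ Clay.  0 `sorry`, 0 `def`, standard axioms.

THE POINT.  [B9]'s fourth (3.42) entry `|(Δ_U G(U)λ)(x)| ≤ B₀e^{−δ₀d(y,y′)}|λ|` (prefactor `1`) needs no new induction: `G = A₀⁻¹` solves its own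
equation.  With `A₀ = lapF (L^K)² m² + a_K·blockProj = m² − Δ^η + a_K·Q*Q` (`King1986.Torus.fineOp`, `lapF_mulVec_apply`),
`Δ^η(A₀⁻¹λ)(x) := (L^K)²·Σ_μ[(A₀⁻¹λ)(x + e_μ) + (A₀⁻¹λ)(x − e_μ) − 2(A₀⁻¹λ)(x)] = m²·(A₀⁻¹λ)(x) + a_K·(Q*QA₀⁻¹λ)(x) − λ(x)` (§3
`lap_inv_mulVec_eq`), so the PAIR difference at the source `λ∘π` is `m²·[entry-0 pair] + a_{K+n}·[block mean of the entry-0 pair over B(x′)] +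
(a_{K+n} − a_K)·(Q*QA₀⁻¹λ)(x) − [λ(πx′) − λ(πx′)]`, the last bracket vanishing identically:
* §1 block means: `blockProj_mulVec_apply`, `sum_blockIndicator` (`Σ_y N^{−(d+1)}[B x = B y] = 1`), `blockMean_abs_le`, `blockMean_pair_eq`
  (`(Q′*Q′g′)(x′) − (Q*Qg)(πx′) = Σ_{y′}N′^{−(d+1)}[B′x′ = B′y′](g′(y′) − g(πy′))`, part P″ `sum_comp_underPtN` + `blockOf_underPtN`);
* §2 `aK_sub_le` — `|a_{K+n} − a_K| ≤ 2a·L^{−2K}` (King's `a_k = a(1 − L⁻²)∕(1 − L^{−2k})`, `EffectiveLaplacianRate.inv_aK_add`);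
* §3 `lap_inv_mulVec_eq` — the equation;
* §4 ★ **`fullPropLapOp_rate_printed`** — for odd `L ≥ 3`, `a > 0`, `m₀² ≥ 0`, `0 ≤ γ ≤ 1`: `∃ C δ > 0 ∀ K n ≥ 1 ∀ cube 2L^e ∀ 0 < m² ≤ m₀² ∀ λ
  (|λ| ≤ F) ∀ D ∈ ℕ ∀ x′` with `λ(y) = 0` whenever `|B(x) − B(y)|_M < D` (`x = πx′`):
  `|(L^nL^K)²·Σ_μ[g′(x′ + e_μ) + g′(x′ − e_μ) − 2g′(x′)] − (L^K)²·Σ_μ[g(x + e_μ) + g(x − e_μ) − 2g(x)]| ≤ C·(L^{−γ∕2})^K·e^{−δD}·F`,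
  `g′ = A₀′⁻¹(λ∘π)`, `g = A₀⁻¹λ` (part P″ `fullPropOp_rate_printed` at every point of the block `B(x′)` + `King1986.Torus.fineOp_inv_mulVec_decay_unif`
  for `|Q*QA₀⁻¹λ| ≤ c₀e^{−δ₀D}F` + §2 with `L^{−2K} ≤ (L^{−γ∕2})^K`).
WHAT THE CURVED CASE ADDS (one line): Bałaban's `Δ_U G_k(U)λ` uniformly over the live window `Reg335` (there the equation carries `Q*(U)Q(U)` and
the covariant Laplacian); print gives analyticity in `U` and η-uniformity, never an η-difference.
HONEST SCOPE.  (i) `A = 0`, periodic b.c., odd `L ≥ 3`, `0 < m² ≤ m₀²`, cubes `2L^e`, `K, n ≥ 1`, `0 ≤ γ ≤ 1`; (ii) `Δ^η` = the η-lattice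
Laplacian `η^{−2}Σ_μ(f(x + ηe_μ) + f(x − ηe_μ) − 2f(x))` (at `U ≡ 1` Bałaban's `Δ_U` IS this); (iii) block-distance currency; not Bałaban's covariant
entry; not a discharge.
Locators: [King1986] C. King, CMP **102** (1986) 649–677: (2.13)–(2.17) p. 653, (4.1)–(4.5) p. 670, Theorem 3.3 (3.7) p. 658, Prop. 3.8 (3.71)
p. 664; [Ba 4] = [Balaban1983RegularityDecay] (1.6) p. 572, Theorem (1.10) p. 573; [B9] = [Balaban1985BackgroundPropagators] Thm 3.1 (3.42) p. 397
+ Thm 3.14 pp. 426–427 (typing template).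
-/

noncomputable section

namespace Summit.QuantumFields.YangMills.BalabanUVNodes.N15KingModelRung.Curved

open Real Finset Matrix
open Literature.MathematicalPhysics.QuantumFieldTheory.Balaban1983to89 (Params)
open Literature.MathematicalPhysics.QuantumFieldTheory.Balaban1983to89.B5Prop11Plancherel (Tor fine unitVec)
open Literature.MathematicalPhysics.QuantumFieldTheory.King1986 (aK aK_pos aK_le aK_ge inv_aK_add)
open Literature.MathematicalPhysics.QuantumFieldTheory.King1986.Torus (constrainedProp fineOp lapF blockProj blockOf tdistT tdistT_nonneg
  fineOp_isUnit lapF_mulVec_apply fineOp_inv_mulVec_decay_unif)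

variable {d : ℕ} (L : ℕ) [NeZero L]

/-! ## §1 Block means on the fine torus -/

omit [NeZero L] in
/-- `(Q*Qg)(x) = Σ_y N^{−(d+1)}·[B x = B y]·g(y)` — King's block-mean projector applied to a field. [cite: King1986, (4.36) p.674, (2.4) p.652] -/
theorem blockProj_mulVec_apply (N : ℕ) [NeZero N] (M : Fin (d + 1) → ℕ) [∀ μ, NeZero (M μ)] (g : Tor (fine N M) → ℝ) (x : Tor (fine N M)) :
    (blockProj N M *ᵥ g) x = ∑ y, (if blockOf N M x = blockOf N M y then ((N : ℝ) ^ (d + 1))⁻¹ else 0) * g y := by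
  simp only [Matrix.mulVec, dotProduct, blockProj]

omit [NeZero L] in
/-- `Σ_y N^{−(d+1)}·[B x = B y] = 1` — a unit block has `N^{d+1}` fine points (part P `sum_fine_blockOf`). [folklore] -/
theorem sum_blockIndicator (N : ℕ) [NeZero N] (M : Fin (d + 1) → ℕ) [∀ μ, NeZero (M μ)] (x : Tor (fine N M)) :
    ∑ y, (if blockOf N M x = blockOf N M y then ((N : ℝ) ^ (d + 1))⁻¹ else (0 : ℝ)) = 1 := by
  have hN : ((N : ℝ) ^ (d + 1)) ≠ 0 := pow_ne_zero _ (by exact_mod_cast NeZero.ne N)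
  rw [sum_fine_blockOf N M (fun b => if blockOf N M x = b then ((N : ℝ) ^ (d + 1))⁻¹ else (0 : ℝ)),
    Finset.sum_ite_eq Finset.univ (blockOf N M x), if_pos (Finset.mem_univ _), mul_inv_cancel₀ hN]

omit [NeZero L] in
/-- **A block mean is bounded by the sup over the block**: `|(Q*Qg)(x)| ≤ S` as soon as `|g(y)| ≤ S` on the block of `x`. [folklore] -/
theorem blockMean_abs_le (N : ℕ) [NeZero N] (M : Fin (d + 1) → ℕ) [∀ μ, NeZero (M μ)] (g : Tor (fine N M) → ℝ) (x : Tor (fine N M))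
    {S : ℝ} (hS : ∀ y, blockOf N M x = blockOf N M y → |g y| ≤ S) :
    |∑ y, (if blockOf N M x = blockOf N M y then ((N : ℝ) ^ (d + 1))⁻¹ else (0 : ℝ)) * g y| ≤ S := by
  have hS0 : 0 ≤ S := (abs_nonneg _).trans (hS x rfl)
  calc |∑ y, (if blockOf N M x = blockOf N M y then ((N : ℝ) ^ (d + 1))⁻¹ else (0 : ℝ)) * g y|
      ≤ ∑ y, |(if blockOf N M x = blockOf N M y then ((N : ℝ) ^ (d + 1))⁻¹ else (0 : ℝ)) * g y| := Finset.abs_sum_le_sum_abs _ _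
    _ ≤ ∑ y, (if blockOf N M x = blockOf N M y then ((N : ℝ) ^ (d + 1))⁻¹ else (0 : ℝ)) * S := by
        refine Finset.sum_le_sum fun y _ => ?_
        by_cases hb : blockOf N M x = blockOf N M y
        · rw [if_pos hb, abs_mul, abs_of_nonneg (by positivity)]
          exact mul_le_mul_of_nonneg_left (hS y hb) (by positivity)
        · rw [if_neg hb, zero_mul, zero_mul, abs_zero]
    _ = S := by rw [← Finset.sum_mul, sum_blockIndicator, one_mul]

/-- **The pair of block means as ONE fine sum**: `(Q′*Q′g′)(x′) − (Q*Qg)(πx′) = Σ_{y′}N′^{−(d+1)}·[B′x′ = B′y′]·(g′(y′) − g(πy′))` (`N′ = L^nL^K`; each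
η-point has `(L^n)^{d+1}` η′-points over it, part P″ `sum_comp_underPtN`; King's pairing preserves unit blocks, `blockOf_underPtN`).
[cite: King1986, (2.4) p.652, p.664 («x′ ∈ B^n(x)»)] -/
theorem blockMean_pair_eq (K n : ℕ) (M : Fin (d + 1) → ℕ) [∀ μ, NeZero (M μ)] (g' : Tor (fine (L ^ n * L ^ K) M) → ℝ)
    (g : Tor (fine (L ^ K) M) → ℝ) (x' : Tor (fine (L ^ n * L ^ K) M)) :
    (blockProj (L ^ n * L ^ K) M *ᵥ g') x' - (blockProj (L ^ K) M *ᵥ g) (underPtN L K n M x')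
      = ∑ y', (if blockOf (L ^ n * L ^ K) M x' = blockOf (L ^ n * L ^ K) M y' then ((((L ^ n * L ^ K : ℕ) : ℝ)) ^ (d + 1))⁻¹ else (0 : ℝ))
          * (g' y' - g (underPtN L K n M y')) := by
  have hL0 : (L : ℝ) ≠ 0 := by exact_mod_cast NeZero.ne L
  have hcoarse : (blockProj (L ^ K) M *ᵥ g) (underPtN L K n M x')
      = ∑ y', (if blockOf (L ^ n * L ^ K) M x' = blockOf (L ^ n * L ^ K) M y' then ((((L ^ n * L ^ K : ℕ) : ℝ)) ^ (d + 1))⁻¹ else (0 : ℝ))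
          * g (underPtN L K n M y') := by
    rw [blockProj_mulVec_apply]
    have h1 := sum_comp_underPtN L K n M (fun y => (if blockOf (L ^ K) M (underPtN L K n M x') = blockOf (L ^ K) M y
      then ((((L ^ n * L ^ K : ℕ) : ℝ)) ^ (d + 1))⁻¹ else (0 : ℝ)) * g y)
    simp only [blockOf_underPtN] at h1
    rw [h1, Finset.mul_sum]
    refine Finset.sum_congr rfl fun y _ => ?_
    rw [blockOf_underPtN]
    by_cases hb : blockOf (L ^ n * L ^ K) M x' = blockOf (L ^ K) M y
    · rw [if_pos hb, if_pos hb]; push_cast; field_simp; ring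
    · rw [if_neg hb, if_neg hb]; ring
  rw [hcoarse, blockProj_mulVec_apply, ← Finset.sum_sub_distrib]
  refine Finset.sum_congr rfl fun y' _ => ?_
  ring

/-! ## §2 King's constants `a_K` converge geometrically -/

omit [NeZero L] in
/-- **`|a_{K+n} − a_K| ≤ 2a·L^{−2K}`** (`a_k = a(1 − L⁻²)∕(1 − L^{−2k})`; from `a_{K+n}⁻¹ = a_K⁻¹ + L^{−2K}a_n⁻¹`, `a_k ≤ a`, `a_n ≥ a(1 − L⁻²) ≥ a∕2`).
[cite: King1986, (2.13) p.653, (4.12) p.671] -/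
theorem aK_sub_le {Lr a : ℝ} (hL : 2 ≤ Lr) (ha : 0 < a) {K n : ℕ} (hK : 1 ≤ K) (hn : 1 ≤ n) :
    |aK a Lr (K + n) - aK a Lr K| ≤ 2 * a * ((Lr ^ (2 * K)))⁻¹ := by
  have hL1 : 1 < Lr := by linarith
  have hL0 : 0 < Lr := by linarith
  have hKn : 1 ≤ K + n := by omega
  have hpos1 := aK_pos ha hL1 hK
  have hpos2 := aK_pos ha hL1 hKn
  have hposn := aK_pos ha hL1 hn
  have hle1 := aK_le ha hL1 hK
  have hle2 := aK_le ha hL1 hKn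
  have hge := aK_ge ha hL1 hn
  have hinv := inv_aK_add ha hL1 K n
  have hq : 0 < ((Lr ^ (2 * K)))⁻¹ := by positivity
  -- `a_K − a_{K+n} = a_K a_{K+n} L^{−2K} ∕ a_n`
  have hid : aK a Lr K - aK a Lr (K + n) = aK a Lr K * aK a Lr (K + n) * (((Lr ^ (2 * K)))⁻¹ * (aK a Lr n)⁻¹) := by
    have h1 : aK a Lr K * aK a Lr (K + n) * ((aK a Lr (K + n))⁻¹ - (aK a Lr K)⁻¹) = aK a Lr K - aK a Lr (K + n) := by
      rw [mul_sub, mul_assoc, mul_inv_cancel₀ hpos2.ne', mul_one, mul_assoc, mul_comm (aK a Lr (K + n)),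
        ← mul_assoc, mul_inv_cancel₀ hpos1.ne', one_mul]
    rw [← h1, hinv]
    ring
  have hhalf : (1 : ℝ) / 2 ≤ 1 - (Lr ^ 2)⁻¹ := by
    have h4 : (4 : ℝ) ≤ Lr ^ 2 := by nlinarith
    have : (Lr ^ 2)⁻¹ ≤ 1 / 4 := by
      rw [inv_le_comm₀ (by positivity) (by norm_num)]
      linarith
    linarith
  have hninv : (aK a Lr n)⁻¹ ≤ 2 / a := by
    have h1 : a / 2 ≤ aK a Lr n := by nlinarith
    calc (aK a Lr n)⁻¹ ≤ (a / 2)⁻¹ := inv_anti₀ (by positivity) h1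
      _ = 2 / a := by rw [inv_div]
  rw [abs_sub_comm, abs_of_nonneg (by rw [hid]; positivity), hid]
  calc aK a Lr K * aK a Lr (K + n) * (((Lr ^ (2 * K)))⁻¹ * (aK a Lr n)⁻¹)
      ≤ a * a * (((Lr ^ (2 * K)))⁻¹ * (2 / a)) := by
        apply mul_le_mul (mul_le_mul hle1 hle2 hpos2.le ha.le) (mul_le_mul_of_nonneg_left hninv hq.le) (by positivity)
          (by positivity)
    _ = 2 * a * ((Lr ^ (2 * K)))⁻¹ := by field_simp

/-! ## §3 The equation: `Δ^ηA₀⁻¹λ = m²A₀⁻¹λ + a·Q*QA₀⁻¹λ − λ` -/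

omit [NeZero L] in
/-- **`A₀⁻¹` SOLVES ITS EQUATION, LAPLACIAN FORM**: for `a ≥ 0`, `c ≥ 0`, `m² > 0` and `g = A₀⁻¹λ` (`A₀ = lapF c m² + a·Q*Q`, `lapF = m² + c·(−Δ)`):
`c·Σ_μ[g(x + e_μ) + g(x − e_μ) − 2g(x)] = m²·g(x) + a·(Q*Qg)(x) − λ(x)` — with `c = (L^K)² = η⁻²` the left side IS `(Δ^ηA₀⁻¹λ)(x)`.
[cite: King1986, (4.1)–(4.5) p.670; Balaban1983RegularityDecay, (1.6) p.572] -/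
theorem lap_inv_mulVec_eq (N : ℕ) [NeZero N] (M : Fin (d + 1) → ℕ) [∀ μ, NeZero (M μ)] {a c m2 : ℝ} (ha : 0 ≤ a) (hc : 0 ≤ c)
    (hm : 0 < m2) (lam : Tor (fine N M) → ℝ) (x : Tor (fine N M)) :
    c * ∑ μ, (((fineOp N M a c m2)⁻¹ *ᵥ lam) (x + unitVec (fine N M) μ) + ((fineOp N M a c m2)⁻¹ *ᵥ lam) (x - unitVec (fine N M) μ)
        - 2 * ((fineOp N M a c m2)⁻¹ *ᵥ lam) x)
      = m2 * ((fineOp N M a c m2)⁻¹ *ᵥ lam) x + a * (blockProj N M *ᵥ ((fineOp N M a c m2)⁻¹ *ᵥ lam)) x - lam x := by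
  set g := (fineOp N M a c m2)⁻¹ *ᵥ lam with hg
  have hdet : IsUnit (fineOp N M a c m2).det := (Matrix.isUnit_iff_isUnit_det _).mp (fineOp_isUnit N M ha hc hm)
  have hAg : fineOp N M a c m2 *ᵥ g = lam := by
    rw [hg, Matrix.mulVec_mulVec, Matrix.mul_nonsing_inv _ hdet, Matrix.one_mulVec]
  have hx : (lapF (fine N M) c m2 *ᵥ g) x + a * (blockProj N M *ᵥ g) x = lam x := by
    have h1 := congrFun hAg x
    rw [fineOp, Matrix.add_mulVec, Matrix.smul_mulVec] at h1
    simpa only [Pi.add_apply, Pi.smul_apply, smul_eq_mul] using h1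
  rw [lapF_mulVec_apply] at hx
  have hsum : ∑ μ : Fin (d + 1), (g (x + unitVec (fine N M) μ) + g (x - unitVec (fine N M) μ) - 2 * g x)
      = ∑ μ : Fin (d + 1), (g (x + unitVec (fine N M) μ) + g (x - unitVec (fine N M) μ)) - 2 * (d + 1 : ℕ) * g x := by
    rw [Finset.sum_sub_distrib, Finset.sum_const, Finset.card_univ, Fintype.card_fin, nsmul_eq_mul]
    ring
  rw [hsum]
  push_cast at hx ⊢
  linarith

/-! ## §4 The printed shape of the Laplacian entry of the pair -/

/-- ★ **ENTRY `|ΔGλ|` OF THE PAIR, PRINTED SHAPE**: for odd `L ≥ 3`, `a > 0`, a mass cap `m₀² ≥ 0` and `0 ≤ γ ≤ 1` there are `C, δ > 0` such that for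
EVERY `K ≥ 1`, `n ≥ 1`, cube `M_μ = 2L^e`, mass `0 < m² ≤ m₀²`, every `λ` on the η-lattice with `|λ| ≤ F`, every `D ∈ ℕ` and fine point `x′` with
`λ(y) = 0` whenever `|B(x) − B(y)|_M < D` (`x = πx′`):
`|(L^nL^K)²·Σ_μ[g′(x′ + e_μ) + g′(x′ − e_μ) − 2g′(x′)] − (L^K)²·Σ_μ[g(x + e_μ) + g(x − e_μ) − 2g(x)]| ≤ C·(L^{−γ∕2})^K·e^{−δD}·F`,
`g′ = A₀′⁻¹(λ∘π)`, `g = A₀⁻¹λ` — [B9]'s fourth (3.42) entry SHAPE at `U ≡ 1` for the pair, through the equation (§3), the entry-0 pair (part P″) at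
every point of the block `B(x′)`, the sup bound with decay of `Q*QA₀⁻¹λ` ([Ba 4] (1.10)) and `|a_{K+n} − a_K| ≤ 2aL^{−2K} ≤ 2a(L^{−γ∕2})^K` (§2).
[cite: Balaban1985BackgroundPropagators, Thm 3.1 (3.42) p.397 (entry shape); King1986, (2.13) p.653, (4.1)–(4.5) p.670, Theorem 3.3 (3.7) p.658, Prop. 3.8 (3.71) p.664; Balaban1983RegularityDecay, (1.6) p.572, Theorem (1.10) p.573] -/
theorem fullPropLapOp_rate_printed (hLodd : Odd L) (hL : 2 ≤ L) {a : ℝ} (ha : 0 < a) {m0sq : ℝ} (hm0 : 0 ≤ m0sq) {γ : ℝ}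
    (hγ0 : 0 ≤ γ) (hγ1 : γ ≤ 1) :
    ∃ C δ : ℝ, 0 < C ∧ 0 < δ ∧ ∀ (K : ℕ), 1 ≤ K → ∀ (n : ℕ), 1 ≤ n →
      ∀ (e : ℕ) (M : Fin (d + 1) → ℕ) [∀ μ, NeZero (M μ)], (∀ μ, M μ = 2 * L ^ e) →
      ∀ (msq : ℝ), 0 < msq → msq ≤ m0sq →
      ∀ (lam : Tor (fine (L ^ K) M) → ℝ) (F : ℝ), (∀ y, |lam y| ≤ F) → ∀ (D : ℕ) (x' : Tor (fine (L ^ n * L ^ K) M)),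
        (∀ y, lam y ≠ 0 → (D : ℝ) ≤ tdistT M (blockOf (L ^ K) M (underPtN L K n M x')) (blockOf (L ^ K) M y)) →
        |(((L ^ n * L ^ K : ℕ) : ℝ) ^ 2) *
              ∑ μ, (((fineOp (L ^ n * L ^ K) M (aK a L (K + n)) (((L ^ n * L ^ K : ℕ) : ℝ) ^ 2) msq)⁻¹
                      *ᵥ (fun y' => lam (underPtN L K n M y'))) (x' + unitVec (fine (L ^ n * L ^ K) M) μ)
                  + ((fineOp (L ^ n * L ^ K) M (aK a L (K + n)) (((L ^ n * L ^ K : ℕ) : ℝ) ^ 2) msq)⁻¹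
                      *ᵥ (fun y' => lam (underPtN L K n M y'))) (x' - unitVec (fine (L ^ n * L ^ K) M) μ)
                  - 2 * ((fineOp (L ^ n * L ^ K) M (aK a L (K + n)) (((L ^ n * L ^ K : ℕ) : ℝ) ^ 2) msq)⁻¹
                      *ᵥ (fun y' => lam (underPtN L K n M y'))) x')
          - (((L ^ K : ℕ) : ℝ) ^ 2) *
              ∑ μ, (((fineOp (L ^ K) M (aK a L K) (((L ^ K : ℕ) : ℝ) ^ 2) msq)⁻¹ *ᵥ lam) (underPtN L K n M x' + unitVec (fine (L ^ K) M) μ)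
                  + ((fineOp (L ^ K) M (aK a L K) (((L ^ K : ℕ) : ℝ) ^ 2) msq)⁻¹ *ᵥ lam) (underPtN L K n M x' - unitVec (fine (L ^ K) M) μ)
                  - 2 * ((fineOp (L ^ K) M (aK a L K) (((L ^ K : ℕ) : ℝ) ^ 2) msq)⁻¹ *ᵥ lam) (underPtN L K n M x'))|
          ≤ C * (((L : ℝ) ^ (-(γ / 2))) ^ K) * Real.exp (-(δ * D)) * F := by
  have hL1 : 1 < L := by omega
  have hL1' : (1 : ℝ) ≤ L := by exact_mod_cast hL1.le
  have hL1r : (1 : ℝ) < L := by exact_mod_cast hL1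
  have hL2r : (2 : ℝ) ≤ L := by exact_mod_cast hL
  have hL0 : (0 : ℝ) < L := by positivity
  set θ : ℝ := (L : ℝ) ^ (-(γ / 2)) with hθdef
  have hθ0 : 0 < θ := Real.rpow_pos_of_pos hL0 _
  have hθL : (L : ℝ)⁻¹ ≤ θ := by
    rw [hθdef, ← Real.rpow_neg_one]
    exact Real.rpow_le_rpow_of_exponent_le hL1' (by linarith)
  have hθ1 : θ ≤ 1 := by
    rw [hθdef]
    exact Real.rpow_le_one_of_one_le_of_nonpos hL1' (by linarith)
  obtain ⟨Cp, δp, hCp, hδp, Hp⟩ := fullPropOp_rate_printed (d := d) L hLodd hL ha hm0 hγ0 hγ1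
  obtain ⟨δ₀, c₀, hδ₀, hc₀, H₀⟩ := fineOp_inv_mulVec_decay_unif (d + 1) L (by omega) ⟨hLodd, hL1⟩ ha hm0
  set δ : ℝ := min δp δ₀ with hδdef
  have hδ : 0 < δ := lt_min hδp hδ₀
  have hδp' : δ ≤ δp := min_le_left _ _
  have hδ0' : δ ≤ δ₀ := min_le_right _ _
  have hEmono : ∀ {r : ℝ} {D : ℕ}, δ ≤ r → Real.exp (-(r * D)) ≤ Real.exp (-(δ * D)) := fun hr =>
    Real.exp_le_exp.mpr (neg_le_neg (mul_le_mul_of_nonneg_right hr (Nat.cast_nonneg _)))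
  set C : ℝ := m0sq * Cp + a * Cp + 2 * a * c₀ + 1 with hCdef
  have hC : 0 < C := by positivity
  refine ⟨C, δ, hC, hδ, ?_⟩
  intro K hK n hn e M _ hM msq hmsq hcap lam F hF D x' hsupp
  have hF0 : 0 ≤ F := (abs_nonneg _).trans (hF (underPtN L K n M x'))
  set E : ℝ := Real.exp (-(δ * D)) with hEdef
  have hE0 : 0 < E := Real.exp_pos _
  have haK : 0 ≤ aK a L K := (aK_pos ha hL1r hK).le
  have haK' : 0 ≤ aK a L (K + n) := (aK_pos ha hL1r (by omega)).le
  have haK'le : aK a L (K + n) ≤ a := aK_le ha hL1r (by omega)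
  -- the two equations
  have hEq' := lap_inv_mulVec_eq (L ^ n * L ^ K) M haK' (sq_nonneg (((L ^ n * L ^ K : ℕ) : ℝ))) hmsq
    (fun y' => lam (underPtN L K n M y')) x'
  have hEq := lap_inv_mulVec_eq (L ^ K) M haK (sq_nonneg (((L ^ K : ℕ) : ℝ))) hmsq lam (underPtN L K n M x')
  set g' : Tor (fine (L ^ n * L ^ K) M) → ℝ :=
    (fineOp (L ^ n * L ^ K) M (aK a L (K + n)) (((L ^ n * L ^ K : ℕ) : ℝ) ^ 2) msq)⁻¹ *ᵥ (fun y' => lam (underPtN L K n M y'))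
    with hg'
  set g : Tor (fine (L ^ K) M) → ℝ := (fineOp (L ^ K) M (aK a L K) (((L ^ K : ℕ) : ℝ) ^ 2) msq)⁻¹ *ᵥ lam with hg
  -- the entry-0 pair at every point of the block of `x′` (same distance `D` to the support: the block IS the coarse block of `x`)
  set S : ℝ := Cp * θ ^ K * Real.exp (-(δp * D)) * F with hSdef
  have hS0 : 0 ≤ S := by positivity
  have hpt : ∀ y', blockOf (L ^ n * L ^ K) M x' = blockOf (L ^ n * L ^ K) M y' → |g' y' - g (underPtN L K n M y')| ≤ S := by
    intro y' hb
    have hsupp' : ∀ y, lam y ≠ 0 → (D : ℝ) ≤ tdistT M (blockOf (L ^ K) M (underPtN L K n M y')) (blockOf (L ^ K) M y) := by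
      intro y hy
      have h := hsupp y hy
      rwa [blockOf_underPtN, hb, ← blockOf_underPtN] at h
    exact Hp K hK n hn e M hM msq hmsq hcap lam F hF D y' hsupp'
  have h0 : |g' x' - g (underPtN L K n M x')| ≤ S := hpt x' rfl
  -- the block means
  have hP : |(blockProj (L ^ n * L ^ K) M *ᵥ g') x' - (blockProj (L ^ K) M *ᵥ g) (underPtN L K n M x')| ≤ S := by
    rw [blockMean_pair_eq]
    exact blockMean_abs_le (L ^ n * L ^ K) M (fun y' => g' y' - g (underPtN L K n M y')) x' hpt
  have hPg : |(blockProj (L ^ K) M *ᵥ g) (underPtN L K n M x')| ≤ c₀ * Real.exp (-(δ₀ * D)) * F := by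
    rw [blockProj_mulVec_apply]
    refine blockMean_abs_le (L ^ K) M g (underPtN L K n M x') fun y hb => ?_
    set P : Params := ⟨d + 1, L, e, K, by omega, ⟨hLodd, hL1⟩⟩ with hP
    have hMK : ∀ μ, M μ = P.sitesPerDir P.K := fun μ => by rw [hM μ]; simp [hP, Params.sitesPerDir]
    have hsuppy : ∀ z, lam z ≠ 0 → (D : ℝ) ≤ tdistT M (blockOf (L ^ K) M y) (blockOf (L ^ K) M z) := by
      intro z hz
      rw [← hb]
      exact hsupp z hz
    exact H₀ P rfl rfl hK msq hmsq.le hcap M hMK (L ^ K) rfl lam F D hF y hsuppy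
  -- the constants' difference
  have haa : |aK a L (K + n) - aK a L K| ≤ 2 * a * θ ^ K := by
    refine (aK_sub_le hL2r ha hK hn).trans (mul_le_mul_of_nonneg_left ?_ (by positivity))
    calc (((L : ℝ) ^ (2 * K)))⁻¹ = ((L : ℝ)⁻¹) ^ (2 * K) := by rw [inv_pow]
      _ ≤ ((L : ℝ)⁻¹) ^ K := pow_le_pow_of_le_one (by positivity) (inv_le_one_of_one_le₀ hL1') (by omega)
      _ ≤ θ ^ K := pow_le_pow_left₀ (by positivity) hθL K
  -- assemble
  have hdiff : (((L ^ n * L ^ K : ℕ) : ℝ) ^ 2) * ∑ μ, (g' (x' + unitVec (fine (L ^ n * L ^ K) M) μ)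
          + g' (x' - unitVec (fine (L ^ n * L ^ K) M) μ) - 2 * g' x')
        - (((L ^ K : ℕ) : ℝ) ^ 2) * ∑ μ, (g (underPtN L K n M x' + unitVec (fine (L ^ K) M) μ)
            + g (underPtN L K n M x' - unitVec (fine (L ^ K) M) μ) - 2 * g (underPtN L K n M x'))
      = msq * (g' x' - g (underPtN L K n M x'))
        + aK a L (K + n) * ((blockProj (L ^ n * L ^ K) M *ᵥ g') x' - (blockProj (L ^ K) M *ᵥ g) (underPtN L K n M x'))
        + (aK a L (K + n) - aK a L K) * (blockProj (L ^ K) M *ᵥ g) (underPtN L K n M x') := by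
    rw [hEq', hEq]
    ring
  have hm0' : msq ≤ m0sq := hcap
  calc |(((L ^ n * L ^ K : ℕ) : ℝ) ^ 2) * ∑ μ, (g' (x' + unitVec (fine (L ^ n * L ^ K) M) μ)
            + g' (x' - unitVec (fine (L ^ n * L ^ K) M) μ) - 2 * g' x')
          - (((L ^ K : ℕ) : ℝ) ^ 2) * ∑ μ, (g (underPtN L K n M x' + unitVec (fine (L ^ K) M) μ)
              + g (underPtN L K n M x' - unitVec (fine (L ^ K) M) μ) - 2 * g (underPtN L K n M x'))|
      = |msq * (g' x' - g (underPtN L K n M x'))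
          + aK a L (K + n) * ((blockProj (L ^ n * L ^ K) M *ᵥ g') x' - (blockProj (L ^ K) M *ᵥ g) (underPtN L K n M x'))
          + (aK a L (K + n) - aK a L K) * (blockProj (L ^ K) M *ᵥ g) (underPtN L K n M x')| := by rw [hdiff]
    _ ≤ |msq * (g' x' - g (underPtN L K n M x'))|
          + |aK a L (K + n) * ((blockProj (L ^ n * L ^ K) M *ᵥ g') x' - (blockProj (L ^ K) M *ᵥ g) (underPtN L K n M x'))|
          + |(aK a L (K + n) - aK a L K) * (blockProj (L ^ K) M *ᵥ g) (underPtN L K n M x')| := abs_add_three _ _ _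
    _ ≤ msq * S + aK a L (K + n) * S + 2 * a * θ ^ K * (c₀ * Real.exp (-(δ₀ * D)) * F) := by
        rw [abs_mul, abs_mul, abs_mul, abs_of_nonneg hmsq.le, abs_of_nonneg haK']
        exact add_le_add (add_le_add (mul_le_mul_of_nonneg_left h0 hmsq.le) (mul_le_mul_of_nonneg_left hP haK'))
          (mul_le_mul haa hPg (abs_nonneg _) (by positivity))
    _ ≤ m0sq * (Cp * θ ^ K * E * F) + a * (Cp * θ ^ K * E * F) + 2 * a * θ ^ K * (c₀ * E * F) := by
        have hS' : S ≤ Cp * θ ^ K * E * F :=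
          mul_le_mul_of_nonneg_right (mul_le_mul_of_nonneg_left (hEmono hδp') (by positivity)) hF0
        have h3 : c₀ * Real.exp (-(δ₀ * D)) * F ≤ c₀ * E * F :=
          mul_le_mul_of_nonneg_right (mul_le_mul_of_nonneg_left (hEmono hδ0') hc₀.le) hF0
        have hq : 0 ≤ Cp * θ ^ K * E * F := by positivity
        refine add_le_add (add_le_add ?_ ?_) (mul_le_mul_of_nonneg_left h3 (by positivity))
        · exact (mul_le_mul_of_nonneg_left hS' hmsq.le).trans (mul_le_mul_of_nonneg_right hm0' hq)
        · exact (mul_le_mul_of_nonneg_left hS' haK').trans (mul_le_mul_of_nonneg_right haK'le hq)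
    _ = (m0sq * Cp + a * Cp + 2 * a * c₀) * θ ^ K * E * F := by ring
    _ ≤ C * θ ^ K * E * F := by gcongr; rw [hCdef]; linarith

end Summit.QuantumFields.YangMills.BalabanUVNodes.N15KingModelRung.Curved
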